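import Summits.FinalStateConjecture.FinalStateConjecture.Theses.RootDecompFarLedgerCells

/-!
# `RootDecompFarLedgerCells.NoChargeExitGlue` (stmt-FinalStateConjecture-29292) — proof

Stand-alone proof (imports only the route file) of the GLUE support item of the gen-1 split of
`RootDecompFarLedgerCells.NoChargeExit` (stmt-FinalStateConjecture-28426, the no-account cell N of the bounded
censored single-hole residual) into its two cells `FarAccountDoor` (stmt-29290, sole-end tail in the
Klainerman–Nicolò class) and `RoughTailExit` (stmt-29291, tail outside it): children ⟹ parent. Written by a
planner lens seat of the decomp-fsc cell (lens-5 «finite range + asymptotic regime + bridge», generations 7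
and 23; the in-HOME kernel version is `FarLedgerCells.noCharge_of_cells`, lens-5 g6) for a prover seat to
file; re-proved here directly on the tree decls without the lens's cell vocabulary.

Statement (the tree decl, BY NAME): `FarAccountDoor → RoughTailExit → NoChargeExit`.

Proof: the three decls share the same `let`-bound predicates `P`, `Pw0`, `Disp`, `Trap`, `Cens`, `Single`,
`CenFinF` (the cell 𝓒_B), `MassF`, `AreaF`, `Acc` (an honest final Bondi account exists) and the children
moreover `KN` (some sole-end chart has a Klainerman–Nicolò tail); the parent asks for a tame admissible exit
through `P` at every admissible `P`-exceptional datum of 𝓒_B with `¬Acc`, the children ask for it on the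
sub-populations `¬Acc ∧ KN` and `¬Acc ∧ ¬KN`, which exhaust it by one excluded middle. Pure logic; no geometry
is used.
-/

-- D-0017: single-problem summit, `Summit.<S>.<S>.…` by design (cf. lakefile `weak.linter.dupNamespace`).
set_option linter.dupNamespace false

namespace Summit.FinalStateConjecture.FinalStateConjecture.Theorems.RootDecompFarLedgerCellsNoChargeExitGlue

/-- **Glue of the far-ledger split** (stmt-FinalStateConjecture-29292, BY NAME): if the Klainerman–Nicolò
door and the rough-tail cell each admit tame admissible exits through the summit property, then so does the
whole no-account cell — the two cells exhaust it by excluded middle on «some sole-end chart has a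
Klainerman–Nicolò tail». -/
theorem noChargeExitGlue : Theses.RootDecompFarLedgerCells.NoChargeExitGlue := by
  intro hDoor hRough X _ _ _ _ _ _
  have hDoor' := hDoor X
  have hRough' := hRough X
  dsimp only at hDoor' hRough' ⊢
  intro d hd hnP hB hnAcc
  exact (Classical.em _).elim (fun hKN ↦ hDoor' d hd hnP hB ⟨hnAcc, hKN⟩)
    fun hKN ↦ hRough' d hd hnP hB ⟨hnAcc, hKN⟩

end Summit.FinalStateConjecture.FinalStateConjecture.Theorems.RootDecompFarLedgerCellsNoChargeExitGlue
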